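import Literature.NumberTheory.LFunctions.ZeroCountingSelbergProofs
import HarnessLib

-- `linter.dupNamespace` is off because the landed sibling files of this line all use the namespace
-- `Summit.RiemannHypothesis.RiemannHypothesis.Theorems.RuelleBandCofiniteCriticalLine`.
set_option linter.dupNamespace false

/-!
# Stub `stub_distinctZeroCount_ge_selberg` — `N_d(T) ≥ c₁ T log T`, unconditionally (Selberg 1942)

Stub C4 of line `cofinite-weil-index-staircase` (crux `RuelleBand.CofiniteCriticalLine`): the number
`N_d(T) = distinctZeroCount T` of *distinct* zeros `ρ` of `ζ` with `0 ≤ Re ρ ≤ 1`, `0 < Im ρ ≤ T`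
satisfies `N_d(T) ≥ c₁ T log T` for some `c₁ > 0` and all large `T`.

This is the elementary end of the proof of Titchmarsh's Theorem 10.22 (Selberg's theorem
`N₀(T) > A T log T`), run with the *distinct* count in place of `N₀`: the measure form
`volume {t ∈ [T, 2T] | ∃ γ ∈ (t, t + 2πA/log T), ζ(½ + iγ) = 0} ≥ cT`
(`SelbergMollifier.selberg_volume_criticalZeros_ge`, now unconditional since Titchmarsh's Lemmas
10.17, 10.18, 10.20 are theorems) is combined with the covering step of
`Literature/NumberTheory/LFunctions/ZeroCountingSelbergProofs.lean`, whose union is indexed by the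
*distinct* ordinates `γ ∈ (T, 2T + h]` of critical zeros; these inject into the box
`zetaZeroBox 0 (2T + h)` by `γ ↦ ½ + iγ`, so `cT ≤ h · N_d(3T)` with `h = 2πA/log T ≤ 1`, and the
arithmetic of `exists_le_criticalZeroCount_of_volume_criticalZeros_ge` finishes. (The statement is
not a corollary of `selberg_criticalZeroCount_ge : N₀(T) ≥ c₁ T log T`, since
`N₀ = criticalZeroCount` counts zeros with multiplicity while `N_d` does not; hence the covering
step is re-run here.)
-/

noncomputable section

open Complex Real MeasureTheory Set Filter

namespace Summit.RiemannHypothesis.RiemannHypothesis.Theorems.RuelleBandCofiniteCriticalLine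

open Literature.NumberTheory.LFunctions

/-- `N_d` is non-decreasing: `zetaZeroBox 0 u ⊆ zetaZeroBox 0 v` for `u ≤ v`. [folklore] -/
theorem stub_distinctZeroCount_ge_selberg_mono {u v : ℝ} (h : u ≤ v) :
    distinctZeroCount u ≤ distinctZeroCount v := by
  unfold distinctZeroCount
  refine Set.ncard_le_ncard ?_ (zetaZeroBox_finite 0 v)
  rintro ρ ⟨h0, h1, h2, h3, h4⟩
  exact ⟨h0, h1, h2, h3, h4.trans h⟩

/-- The distinct ordinates `γ ∈ (T, T'']` (`T ≥ 0`) of zeros of `ζ` on the critical line inject into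
the box of distinct zeros `zetaZeroBox 0 T''` by `γ ↦ ½ + iγ`, so there are at most `N_d(T'')` of
them. [folklore] -/
theorem stub_distinctZeroCount_ge_selberg_card_le {T T'' : ℝ} (hT : 0 ≤ T)
    (hZ : {γ : ℝ | riemannZeta (1 / 2 + γ * I) = 0 ∧ T < γ ∧ γ ≤ T''}.Finite) :
    hZ.toFinset.card ≤ distinctZeroCount T'' := by
  classical
  rw [distinctZeroCount, Set.ncard_eq_toFinset_card _ (zetaZeroBox_finite 0 T'')]
  refine Finset.card_le_card_of_injOn (fun γ : ℝ ↦ (1 / 2 + γ * I : ℂ)) ?_ ?_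
  · intro γ hγ
    obtain ⟨hz, hγ₁, hγ₂⟩ := (Finite.mem_toFinset hZ).1 (Finset.mem_coe.1 hγ)
    rw [Finset.mem_coe, Finite.mem_toFinset]
    refine ⟨hz, ?_, ?_, ?_, ?_⟩
    · simp
    · norm_num
    · simpa using hT.trans_lt hγ₁
    · simpa using hγ₂
  · intro x _ y _ hxy
    have h := congrArg Complex.im hxy
    simpa using h

/-- **The covering step of Titchmarsh's Theorem 10.22 with the distinct count.** For `0 ≤ T`, any
`T'` and `H > 0`, the set of `t ∈ [T, T']` for which `ζ(½ + iγ) = 0` for some `γ ∈ (t, t + H)`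
lies in `⋃_γ (γ − H, γ)`, the union over the distinct ordinates `γ ∈ (T, T' + H]` of critical
zeros, of which there are at most `N_d(T' + H)`; hence its Lebesgue measure is at most
`H · N_d(T' + H)`.
[cite: Titchmarsh1986, Theorem 10.22 (proof, last paragraph)] -/
theorem stub_distinctZeroCount_ge_selberg_volume_le {T T' H : ℝ} (hT : 0 ≤ T) (hH : 0 < H) :
    volume {t : ℝ | t ∈ Icc T T' ∧ ∃ γ ∈ Ioo t (t + H), riemannZeta (1 / 2 + γ * I) = 0} ≤
      ENNReal.ofReal (H * (distinctZeroCount (T' + H) : ℝ)) := by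
  classical
  have hZ : {γ : ℝ | riemannZeta (1 / 2 + γ * I) = 0 ∧ T < γ ∧ γ ≤ T' + H}.Finite :=
    finite_setOf_criticalOrdinate_Ioc hT
  -- the covering
  have hcover : {t : ℝ | t ∈ Icc T T' ∧ ∃ γ ∈ Ioo t (t + H), riemannZeta (1 / 2 + γ * I) = 0} ⊆
      ⋃ γ ∈ hZ.toFinset, Ioo (γ - H) γ := by
    rintro t ⟨⟨hTt, htT'⟩, γ, ⟨htγ, hγt⟩, hz⟩
    simp only [mem_iUnion, Finite.mem_toFinset, mem_setOf_eq, exists_prop]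
    exact ⟨γ, ⟨hz, by linarith, by linarith⟩, by linarith, htγ⟩
  -- the count
  have hcount : hZ.toFinset.card ≤ distinctZeroCount (T' + H) :=
    stub_distinctZeroCount_ge_selberg_card_le hT hZ
  have hcount' : (hZ.toFinset.card : ℝ) ≤ distinctZeroCount (T' + H) := by
    exact_mod_cast hcount
  calc volume {t : ℝ | t ∈ Icc T T' ∧ ∃ γ ∈ Ioo t (t + H), riemannZeta (1 / 2 + γ * I) = 0}
      ≤ volume (⋃ γ ∈ hZ.toFinset, Ioo (γ - H) γ) := measure_mono hcover
    _ ≤ ∑ γ ∈ hZ.toFinset, volume (Ioo (γ - H) γ) := measure_biUnion_finset_le _ _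
    _ = ∑ γ ∈ hZ.toFinset, ENNReal.ofReal H := by
        refine Finset.sum_congr rfl fun γ _ ↦ ?_
        rw [Real.volume_Ioo]
        congr 1
        ring
    _ = (hZ.toFinset.card : ENNReal) * ENNReal.ofReal H := by
        rw [Finset.sum_const, nsmul_eq_mul]
    _ = ENNReal.ofReal ((hZ.toFinset.card : ℝ) * H) := by
        rw [ENNReal.ofReal_mul (Nat.cast_nonneg _), ENNReal.ofReal_natCast]
    _ ≤ ENNReal.ofReal (H * (distinctZeroCount (T' + H) : ℝ)) := by
        apply ENNReal.ofReal_le_ofReal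
        calc (hZ.toFinset.card : ℝ) * H
            ≤ (distinctZeroCount (T' + H) : ℝ) * H := mul_le_mul_of_nonneg_right hcount' hH.le
          _ = H * (distinctZeroCount (T' + H) : ℝ) := mul_comm _ _

/-- **Theorem 10.22 with the distinct count, from the measure form of its proof, with explicit
constants.** If `A, c > 0` and for `T ≥ T₀` the set of `t ∈ [T, 2T]` with a critical zero ordinate
in `(t, t + 2πA/log T)` has measure `≥ cT`, then `N_d(T) ≥ (c/(12πA)) T log T` for
`T ≥ 3 max(T₀, e^{2πA}, 3)`. Proof: with `h = 2πA/log T ≤ 1`, the covering step gives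
`cT ≤ h N_d(2T + h) ≤ h N_d(3T)`, i.e. `N_d(3T) ≥ (c/2πA) T log T`; finally `log(T/3) ≥ ½ log T` for
`T ≥ 9`. (Not a corollary of `exists_le_criticalZeroCount_of_volume_criticalZeros_ge`: `N₀` counts
multiplicity, `N_d` does not.) [cite: Titchmarsh1986, Theorem 10.22] -/
theorem stub_distinctZeroCount_ge_selberg_of_volume_ge {A c T₀ : ℝ} (hA : 0 < A) (hc : 0 < c)
    (hE : ∀ T : ℝ, T₀ ≤ T → ENNReal.ofReal (c * T) ≤
      volume {t : ℝ | t ∈ Icc T (2 * T) ∧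
        ∃ γ ∈ Ioo t (t + 2 * π * A / Real.log T), riemannZeta (1 / 2 + γ * I) = 0}) :
    ∀ T : ℝ, 3 * max T₀ (max (Real.exp (2 * π * A)) 3) ≤ T →
      c / (2 * π * A) / 6 * (T * Real.log T) ≤ (distinctZeroCount T : ℝ) := by
  -- Step 1: `N_d(3T) ≥ (c / 2πA) T log T` for `T ≥ T₂ = max T₀ (max (exp 2πA) 3)`
  have step : ∀ T : ℝ, max T₀ (max (Real.exp (2 * π * A)) 3) ≤ T →
      c / (2 * π * A) * (T * Real.log T) ≤ (distinctZeroCount (3 * T) : ℝ) := by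
    intro T hT
    have hT₀ : T₀ ≤ T := le_trans (le_max_left _ _) hT
    have hTexp : Real.exp (2 * π * A) ≤ T :=
      le_trans (le_trans (le_max_left _ _) (le_max_right _ _)) hT
    have hT3 : 3 ≤ T := le_trans (le_trans (le_max_right _ _) (le_max_right _ _)) hT
    have hlog : 0 < Real.log T := Real.log_pos (by linarith)
    have hlogA : 2 * π * A ≤ Real.log T := by
      have h1 := Real.log_le_log (Real.exp_pos _) hTexp
      rwa [Real.log_exp] at h1
    have hET := hE T hT₀
    set H : ℝ := 2 * π * A / Real.log T with hHdef
    have hH0 : 0 < H := by rw [hHdef]; positivity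
    have hH1 : H ≤ 1 := by rwa [hHdef, div_le_one hlog]
    have hvol := hET.trans
      (stub_distinctZeroCount_ge_selberg_volume_le (T := T) (T' := 2 * T) (H := H) (by linarith)
        hH0)
    have hmono : (distinctZeroCount (2 * T + H) : ℝ) ≤ distinctZeroCount (3 * T) := by
      exact_mod_cast stub_distinctZeroCount_ge_selberg_mono (by linarith : 2 * T + H ≤ 3 * T)
    have hnn : 0 ≤ H * (distinctZeroCount (2 * T + H) : ℝ) :=
      mul_nonneg hH0.le (Nat.cast_nonneg _)
    rw [ENNReal.ofReal_le_ofReal_iff hnn] at hvol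
    have e1 : H * (distinctZeroCount (2 * T + H) : ℝ) ≤ H * distinctZeroCount (3 * T) :=
      mul_le_mul_of_nonneg_left hmono hH0.le
    have h1 : c * T ≤ H * (distinctZeroCount (3 * T) : ℝ) := by linarith
    have hHlog : H * (Real.log T / (2 * π * A)) = 1 := by
      rw [hHdef]
      field_simp
    calc c / (2 * π * A) * (T * Real.log T) = c * T * (Real.log T / (2 * π * A)) := by ring
      _ ≤ H * (distinctZeroCount (3 * T) : ℝ) * (Real.log T / (2 * π * A)) :=
          mul_le_mul_of_nonneg_right h1 (by positivity)
      _ = (distinctZeroCount (3 * T) : ℝ) * (H * (Real.log T / (2 * π * A))) := by ring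
      _ = (distinctZeroCount (3 * T) : ℝ) := by rw [hHlog, mul_one]
  -- Step 2: all large `U`, via `T = U/3` and `log (U/3) ≥ (log U)/2` for `U ≥ 9`
  intro U hU
  have hm : (3 : ℝ) ≤ max T₀ (max (Real.exp (2 * π * A)) 3) :=
    le_trans (le_max_right _ _) (le_max_right _ _)
  have hU9 : 9 ≤ U := by linarith
  have hstep := step (U / 3) (by linarith)
  have h3U : 3 * (U / 3) = U := by ring
  rw [h3U] at hstep
  have hlogU : Real.log U ≤ 2 * Real.log (U / 3) := by
    have hU3 : 3 ≤ U / 3 := by linarith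
    have e : Real.log U = Real.log (U / 3) + Real.log 3 := by
      rw [Real.log_div (by linarith) (by norm_num)]
      ring
    have h3 : Real.log 3 ≤ Real.log (U / 3) := Real.log_le_log (by norm_num) hU3
    linarith
  calc c / (2 * π * A) / 6 * (U * Real.log U)
      = c / (2 * π * A) * (U / 3 * (Real.log U / 2)) := by ring
    _ ≤ c / (2 * π * A) * (U / 3 * Real.log (U / 3)) := by
        apply mul_le_mul_of_nonneg_left _ (by positivity)
        apply mul_le_mul_of_nonneg_left _ (by positivity)
        linarith
    _ ≤ (distinctZeroCount U : ℝ) := hstep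

/-- **`N_d(T) ≥ c₁ T log T` unconditionally (Selberg 1942, via Titchmarsh's Theorem 10.22).**
There is `c₁ > 0` such that the number of distinct zeros of `ζ` with `0 < Im ρ ≤ T` is at least
`c₁ T log T` for all large `T`: the measure form `SelbergMollifier.selberg_volume_criticalZeros_ge`
of Theorem 10.22, fed with the proved Lemmas 10.17, 10.18, 10.20, followed by
`stub_distinctZeroCount_ge_selberg_of_volume_ge`. (Not a corollary of
`selberg_criticalZeroCount_ge`, the statement of the same shape for `N₀ = criticalZeroCount`,
which counts multiplicity while `N_d = distinctZeroCount` does not; `distinctZeroCount` is written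
fully qualified below to keep the two statements textually apart.)
[cite: Titchmarsh1986, Theorem 10.22] -/
theorem stub_distinctZeroCount_ge_selberg :
    ∃ c₁ : ℝ, 0 < c₁ ∧ ∃ T₁ : ℝ, ∀ T : ℝ, T₁ ≤ T →
      c₁ * (T * Real.log T) ≤ (Literature.NumberTheory.LFunctions.distinctZeroCount T : ℝ) :=
  (SelbergMollifier.selberg_volume_criticalZeros_ge
      SelbergMollifier.Titchmarsh1986_lemma_10_17_holds
      SelbergMollifier.Titchmarsh1986_lemma_10_18_holds
      SelbergMollifier.Titchmarsh1986_lemma_10_20_dyadic_holds).elim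
    fun A ⟨hA, c, hc, _, hE⟩ ↦
      ⟨c / (2 * π * A) / 6, by positivity, _,
        stub_distinctZeroCount_ge_selberg_of_volume_ge hA hc hE⟩

end Summit.RiemannHypothesis.RiemannHypothesis.Theorems.RuelleBandCofiniteCriticalLine
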